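import Summits.KontsevichZagierPeriods.Zeta5Search.WedgeDictionaryGaugeStep
import HarnessLib

/-!
# The `Q`-part of the wedge dictionary, in the conjecture's own words (cell `pub-zeta5`, TYPER g6)

HONEST FRAMING: systematic search; no irrationality claim unless certified.

`WedgeDictionary.wedgeDictionary` (gen-1, internally minted, `@[conjecture]`) asserts, for `a` in the convergence cone
with dual parameters `b = b(a)` satisfying `0 ≤ 2b_i ≤ b₀ + 1`, `d(b) ≥ 0` and an admissible partner `j`
(`2(b_j + 1) ≤ b₀ + 1`), (i) `Q(a) = ρ(a)·(U(b)W(b′) − U(b′)W(b))` with `b′ = b + e_j`, and (ii) an identity for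
the cellular integral.  With CF-M3 (`OmegaRec.casoratianClosedForm_holds`, gen-1 g5 / lit g4, filed by typer) and
CF-Q (`QWedgeClosedForm_holds`, typer g6) both in the tree, `OmegaRec.qPart_holds` gives (i) in its j-free form
`Q(a) = ρ(a)·M₃(b(a))`; this file states **(i) literally** (`wedgeDictionary_Q`) via `Q_part_iff_quadM3`, and the
decomposition `wedgeDictionary ↔ (ii)` that remains (`wedgeDictionary_iff_integralPart`): the open half of the
conjecture is now exactly the cellular-integral identity.
-/

noncomputable section

open Finset

namespace Summit.KontsevichZagierPeriods.Zeta5Search.WedgeDictionary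

open Summit.KontsevichZagierPeriods.Zeta5Search.DualSeries
open Literature.NumberTheory.Irrationality.BrownZudilin2022 (bOfA Converges QOf cellularIntegral vwpDual)
open Literature.NumberTheory.Transcendental (zetaValue)

/-- **The first conjunct of `wedgeDictionary`, PROVED**: for `a` in the region and an admissible partner `j`,
`Q(a) = ρ(a) · (U(b)W(b′) − U(b′)W(b))`, `b = b(a)`, `b′ = b + e_j`. -/
theorem wedgeDictionary_Q (a : Fin 8 → ℤ) (j : ℕ) (hj : j ∈ Icc 1 7) (hconv : Converges a)
    (hreg : ∀ i ∈ Icc 1 7, 0 ≤ bOfA a i ∧ 2 * bOfA a i ≤ bOfA a 0 + 1) (hd : 0 ≤ dOf (bOfA a))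
    (hpart : 2 * (bOfA a j + 1) ≤ bOfA a 0 + 1) :
    (QOf a : ℚ) = rhoOf a * (coeffU (bOfA a) * coeffW (Function.update (bOfA a) j (bOfA a j + 1)) -
        coeffU (Function.update (bOfA a) j (bOfA a j + 1)) * coeffW (bOfA a)) :=
  (Q_part_iff_quadM3 a hj hreg hd hpart).2 (OmegaRec.qPart_holds a hconv hreg hd)

/-- The integral half of the conjecture, isolated: `I(a) = 2ρ·[(W(b′) − 2ζ(2)U(b′))·F̃₇(b) − (W(b) − 2ζ(2)U(b))·F̃₇(b′)]`
for every `a`, `j` in the region of `wedgeDictionary` (still a CONJECTURE — internally minted; evidence in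
gen-1's DICTIONARY.md). -/
@[conjecture] def wedgeDictionaryIntegralPart : Prop :=
  ∀ (a : Fin 8 → ℤ) (j : ℕ), j ∈ Icc 1 7 → Converges a →
    (∀ i ∈ Icc 1 7, 0 ≤ bOfA a i ∧ 2 * bOfA a i ≤ bOfA a 0 + 1) → 0 ≤ dOf (bOfA a) →
    2 * (bOfA a j + 1) ≤ bOfA a 0 + 1 →
    let b := bOfA a
    let b' := Function.update b j (b j + 1)
    cellularIntegral a =
      2 * (rhoOf a : ℝ) *
        (((coeffW b' : ℝ) - 2 * zetaValue 2 * coeffU b') * vwpDual 7 b -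
          ((coeffW b : ℝ) - 2 * zetaValue 2 * coeffU b) * vwpDual 7 b')

/-- **What is left of `wedgeDictionary` is exactly its integral half**: `wedgeDictionary ↔ wedgeDictionaryIntegralPart`
(the `Q`-half being the theorem `wedgeDictionary_Q`). -/
theorem wedgeDictionary_iff_integralPart : wedgeDictionary ↔ wedgeDictionaryIntegralPart := by
  constructor
  · intro h a j hj hconv hreg hd hpart
    exact (h a j hj hconv hreg hd hpart).2
  · intro h a j hj hconv hreg hd hpart
    exact ⟨wedgeDictionary_Q a j hj hconv hreg hd hpart, h a j hj hconv hreg hd hpart⟩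

end Summit.KontsevichZagierPeriods.Zeta5Search.WedgeDictionary
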